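import Literature.AlgebraicGeometry.Resolution.FBlowup
import Literature.AlgebraicGeometry.Resolution.FrobeniusNormLocalization
import Literature.AlgebraicGeometry.Resolution.FFinite
import Literature.AlgebraicGeometry.Resolution.KunzRegularityCriterion
import Literature.AlgebraicGeometry.Resolution.RegularLocusOpen
import Mathlib.RingTheory.LocalRing.Module
import Mathlib.RingTheory.RingHom.Flat
import Mathlib.AlgebraicGeometry.Morphisms.IsIso
import Mathlib.AlgebraicGeometry.Noetherian
import HarnessLib

/-!
# Crux `WeightedThesis` (stmt-ResolutionOfSingularities-0569), line `kunz-tower-exceptional-defect`,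
# stub `stub_kunzIso`: an F-blowup is an isomorphism over the regular locus (Kunz ⇒ Yasuda 2.7)

T. Yasuda, Amer. J. Math. 134 (2012) = arXiv:0706.2700, Prop. 2.7 / Cor. 2.6: `FB_e(X) → X` is an
isomorphism over the regular locus. In the tree's rendering (`IsFBlowup`: over each nonempty
affine open `Spec A` a blowing up of a Frobenius norm ideal `[[F^e_* A]]`): (1) at a regular
prime `𝔭` the Frobenius of `A_𝔭` is flat (Kunz 1969, Thm. 2.1 — the HYPOTHESIS of the stub), so
its iterate is; (2) `A_𝔭` is F-finite (FFinite.lean) and flat, hence FREE over its `q`-th powers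
(`Module.free_of_flat_of_isLocalRing`), with a basis in `A`; (3) then the Frobenius norm
`[[F^e_* A_𝔭]]_β ⊆ K` is PRINCIPAL (`det_γ(m') = det(c)^q` for every tuple `m'`); (4) hence
`t · I ⊆ (j) ⊆ I` for some `t ∉ 𝔭`, `j ≠ 0`: the centre `Ĩ` is an effective Cartier divisor on
`D(t)`, the blowing up is an isomorphism there (`IsBlowup.isIso`), and `IsIso` is local on the
target. Sources: [Yasuda2012] Prop. 2.7, Cor. 2.6; [Kunz1969] Thm. 2.1; [Villamayoru2006] 3.4.
-/

noncomputable section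

set_option linter.dupNamespace false -- mandated namespace of this single-conjunct summit

namespace Summit.ResolutionOfSingularities.ResolutionOfSingularities.Theorems.WeightedThesis.KunzTower

open CategoryTheory AlgebraicGeometry TopologicalSpace Module
open Literature.AlgebraicGeometry.Resolution

/-- If the Frobenius of `R` is flat then so is its `e`-th iterate. [folklore] -/
theorem flat_iterateFrobenius {p : ℕ} {R : Type*} [CommRing R] [ExpChar R p]
    (h : (frobenius R p).Flat) (e : ℕ) : (iterateFrobenius R p e).Flat := by
  induction e with
  | zero => rw [iterateFrobenius_zero]; exact RingHom.Flat.id R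
  | succ n ih => rw [iterateFrobenius_add, iterateFrobenius_one]; exact h.comp ih

/-- **F-finite + Frobenius-flat local domain ⇒ free over the `q`-th powers, basis in the base**:
if `R = A_M` is a local domain of characteristic `p`, F-finite at level `e`, with flat iterated
Frobenius, then (`Module.free_of_flat_of_isLocalRing` over `R^q ≅ R`; replace `bᵢ = aᵢ/tᵢ` by
`tᵢ^q bᵢ ∈ A`) some finite family `m` in `A` has every `r ∈ R` uniquely `∑ cᵢ^q mᵢ`, `cᵢ ∈ R`.
[cite: Kunz1969, Thm. 2.1] -/
theorem exists_frobeniusBasis_of_flat {p : ℕ} [Fact p.Prime] {e : ℕ} {A R : Type} [CommRing A]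
    [CommRing R] [IsDomain R] [CharP R p] [IsLocalRing R] [Algebra A R] (M : Submonoid A)
    [IsLocalization M R] (hF : IsFFinite p e R) (hflat : (iterateFrobenius R p e).Flat) :
    ∃ (κ : Type) (_ : Fintype κ) (m : κ → A),
      (∀ r : R, ∃ c : κ → R, r = ∑ i, c i ^ p ^ e * algebraMap A R (m i)) ∧
      (∀ c : κ → R, ∑ i, c i ^ p ^ e * algebraMap A R (m i) = 0 → ∀ i, c i = 0) := by
  classical
  let φ : R →+* R := iterateFrobenius R p e
  let S : Subring R := φ.range
  have hinj : Function.Injective φ := iterateFrobenius_inj R p e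
  let ψ : R →+* S := φ.rangeRestrict
  have hψ : Function.Bijective ψ :=
    ⟨fun x y hxy => hinj (Subtype.ext_iff.mp hxy), φ.rangeRestrict_surjective⟩
  have hψval : ∀ x : R, ((ψ x : S) : R) = x ^ p ^ e := fun x => rfl
  -- `R` is flat, finite, hence free over the local ring `S ≅ R`
  haveI : Module.Flat S R := by
    refine RingHom.flat_algebraMap_iff.mp ?_
    have hcomp : S.subtype.comp ψ = φ := RingHom.ext fun x => rfl
    rw [Algebra.algebraMap_ofSubring, ← RingHom.Flat.comp_iff_of_bijective_right hψ, hcomp]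
    exact hflat
  haveI : IsLocalRing S := (RingEquiv.ofBijective ψ hψ).isLocalRing
  obtain ⟨n, s, hs⟩ := hF
  haveI : Module.Finite S R := by
    refine ⟨⟨Finset.univ.image s, eq_top_iff.mpr fun r _ => ?_⟩⟩
    obtain ⟨c, hc⟩ := hs r
    rw [Finset.coe_image, Finset.coe_univ, Set.image_univ, hc]
    refine Submodule.sum_mem _ fun i _ => ?_
    have : c i ^ p ^ e * s i = (ψ (c i)) • s i := by rw [Subring.smul_def, smul_eq_mul, hψval]
    exact this ▸ Submodule.smul_mem _ _ (Submodule.subset_span (Set.mem_range_self i))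
  haveI : Module.Free S R := Module.free_of_flat_of_isLocalRing
  let B := Module.Free.chooseBasis S R
  -- move the basis into `A`: `B i * tᵢ = aᵢ`, `mᵢ = tᵢ ^ (q - 1) * aᵢ`, `wᵢ tᵢ = 1`
  obtain ⟨q₀, hq₀⟩ : ∃ q₀ : ℕ, p ^ e = q₀ + 1 :=
    ⟨p ^ e - 1, (Nat.sub_add_cancel (Nat.one_le_pow _ _ (Fact.out : p.Prime).pos)).symm⟩
  choose pr hpr using fun i => IsLocalization.surj M (B i)
  choose w hw using fun i => (IsLocalization.map_units R (pr i).2).exists_left_inv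
  have hm : ∀ i, algebraMap A R (((pr i).2 : A) ^ q₀ * (pr i).1) =
      algebraMap A R (pr i).2 ^ p ^ e * B i := fun i => by
    rw [map_mul, map_pow, ← hpr i, hq₀]; ring
  refine ⟨_, inferInstance, fun i => ((pr i).2 : A) ^ q₀ * (pr i).1, fun r => ?_, fun c hc i => ?_⟩
  · choose y hy using fun i => ((B.repr r i).2 : ∃ y : R, φ y = (B.repr r i : R))
    refine ⟨fun i => y i * w i, ?_⟩
    calc r = ∑ i, B.repr r i • B i := (B.sum_repr r).symm
      _ = _ := Finset.sum_congr rfl fun i _ => ?_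
    rw [Subring.smul_def, smul_eq_mul, ← hy i, hm i, mul_pow, show φ (y i) = y i ^ p ^ e from rfl]
    have h1 : w i ^ p ^ e * (algebraMap A R (pr i).2 ^ p ^ e * B i) =
        (w i * algebraMap A R (pr i).2) ^ p ^ e * B i := by ring
    rw [mul_assoc, h1, hw i, one_pow, one_mul]
  · have hc' : ∑ i, (ψ (c i * algebraMap A R (pr i).2)) • B i = 0 := by
      rw [← hc]
      refine Finset.sum_congr rfl fun i _ => ?_
      rw [Subring.smul_def, smul_eq_mul, hψval, hm i]
      ring
    have h1 : (c i * algebraMap A R (pr i).2) ^ p ^ e = 0 :=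
      congrArg Subtype.val (Fintype.linearIndependent_iff.mp B.linearIndependent _ hc' i)
    have h2 := (pow_eq_zero_iff (pow_ne_zero e (Fact.out : p.Prime).ne_zero)).mp h1
    calc c i = c i * (w i * algebraMap A R (pr i).2) := by rw [hw i, mul_one]
      _ = 0 := by rw [mul_left_comm, h2, mul_zero]

/-- **Free over `R^q` ⇒ the Frobenius norm is principal**: if the domain `R ⊆ K = Frac R` admits a
finite family `m` with every element uniquely `∑ cᵢ^q mᵢ`, then the `mᵢ` form a `K^q`-basis `γ` of
`K`, every tuple `m'` from `R` with coefficient matrix `c` has `det_γ(m') = det(c)^q`, so the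
norm set for `γ` lies in `R` and contains `1`, and `[[F^e_* R]]_β = R · v` with `v^q = det_β(m)`
for every basis `β` (`frobeniusNorm_basis_change`). [cite: Villamayoru2006, Thm. 3.3 and 3.4] -/
theorem frobeniusNorm_eq_span_singleton_of_basis {K : Type} [Field K] {p : ℕ} [ExpChar K p]
    {e : ℕ} {ι : Type} [Fintype ι] [DecidableEq ι] (β : Basis ι (iterateFrobeniusRange K p e) K)
    {R : Type} [CommRing R] [IsDomain R] [Algebra R K] [IsFractionRing R K]
    {κ : Type} [Fintype κ] (m : κ → R)
    (hspan : ∀ r : R, ∃ c : κ → R, r = ∑ i, c i ^ p ^ e * m i)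
    (hind : ∀ c : κ → R, ∑ i, c i ^ p ^ e * m i = 0 → ∀ i, c i = 0) :
    ∃ (σ : ι ≃ κ) (v : K),
      v ^ p ^ e = ((β.det fun i => algebraMap R K (m (σ i)) : iterateFrobeniusRange K p e) : K) ∧
      frobeniusNorm β R = Submodule.span R {v} := by
  classical
  let Kq := iterateFrobeniusRange K p e
  let ρ : K →+* Kq := (iterateFrobenius K p e).rangeRestrictField
  have hρ : ∀ x : K, ((ρ x : Kq) : K) = x ^ p ^ e := fun x => rfl
  let γv : κ → K := fun i => algebraMap R K (m i)
  have hsmul : ∀ (x : K) (i : κ),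
      (ρ x) • algebraMap R K (m i) = x ^ p ^ e * algebraMap R K (m i) :=
    fun x i => by rw [Subfield.smul_def, smul_eq_mul, hρ]
  -- `γv` is linearly independent over `K^q` (clear denominators, use `hind`) and spans `K`
  have hli : LinearIndependent Kq γv := by
    rw [Fintype.linearIndependent_iff]
    intro g hg i
    choose x hx using fun i => mem_iterateFrobeniusRange_iff.mp (g i).2
    obtain ⟨⟨t, ht⟩, hint⟩ :=
      IsLocalization.exist_integer_multiples_of_finite (nonZeroDivisors R) x
    choose a ha using fun i => (hint i : ∃ a : R, algebraMap R K a = (t : R) • x i)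
    have ha' : ∀ i, algebraMap R K (a i) = algebraMap R K t * x i := fun i => by
      rw [ha i, Algebra.smul_def]
    have hsum : algebraMap R K (∑ j, a j ^ p ^ e * m j) =
        (algebraMap R K t) ^ p ^ e * ∑ j, g j • γv j := by
      rw [map_sum, Finset.mul_sum]
      refine Finset.sum_congr rfl fun j _ => ?_
      rw [map_mul, map_pow, ha' j, mul_pow, hx j, Subfield.smul_def, smul_eq_mul, mul_assoc]
    rw [hg, mul_zero, ← map_zero (algebraMap R K)] at hsum
    have hxi : x i = 0 := by
      have := ha' i
      rw [hind a (IsFractionRing.injective R K hsum) i, map_zero, eq_comm, mul_eq_zero] at this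
      exact this.resolve_left (IsFractionRing.to_map_ne_zero_of_mem_nonZeroDivisors ht)
    refine Subtype.ext ((hx i).symm.trans ?_)
    rw [hxi, zero_pow (pow_ne_zero _ (expChar_pos K p).ne')]
    rfl
  have hsp : ⊤ ≤ Submodule.span Kq (Set.range γv) := by
    rw [← span_range_algebraMap_eq_top (K := K) (p := p) (e := e) (A := R), Submodule.span_le]
    rintro _ ⟨r, rfl⟩
    obtain ⟨c, hc⟩ := hspan r
    rw [hc, map_sum]
    refine Submodule.sum_mem _ fun i _ => ?_
    rw [map_mul, map_pow, ← hsmul]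
    exact Submodule.smul_mem _ _ (Submodule.subset_span (Set.mem_range_self i))
  let γ : Basis κ Kq K := Basis.mk hli hsp
  haveI : Module.Finite Kq K := Module.Finite.of_basis β
  have hcard : Fintype.card ι = Fintype.card κ := by
    rw [← Module.finrank_eq_card_basis β, ← Module.finrank_eq_card_basis γ]
  let σ : ι ≃ κ := Fintype.equivOfCardEq hcard
  let γ' : Basis ι Kq K := γ.reindex σ.symm
  have hγ' : ∀ i, γ' i = algebraMap R K (m (σ i)) := fun i => by
    rw [Basis.reindex_apply, Equiv.symm_symm, Basis.mk_apply hli hsp]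
  have hγ'f : (⇑γ' : ι → K) = fun i => algebraMap R K (m (σ i)) := funext hγ'
  -- the norm set for `γ'` lies in `R` and contains `1`
  have hsub : frobeniusNormSet γ' R ⊆ Set.range (algebraMap R K) := by
    rintro d ⟨m', hm'⟩
    choose c hc using fun j => hspan (m' j)
    let C : Matrix ι ι R := Matrix.of fun j i => c j (σ i)
    refine ⟨C.det, pow_expChar_pow_injective (K := K) (p := p) (e := e) ?_⟩
    change algebraMap R K C.det ^ p ^ e = d ^ p ^ e
    have hcoord : ∀ j, algebraMap R K (m' j) = ∑ i, (ρ (algebraMap R K (c j (σ i)))) • γ' i := by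
      intro j
      rw [hc j, map_sum, ← σ.sum_comp]
      refine Finset.sum_congr rfl fun i _ => ?_
      rw [map_mul, map_pow, hγ', Subfield.smul_def, smul_eq_mul, hρ]
    have hM : γ'.toMatrix (fun j => algebraMap R K (m' j)) =
        ((ρ.comp (algebraMap R K)).mapMatrix C).transpose := by
      ext i j
      rw [Basis.toMatrix_apply, hcoord j, Basis.repr_sum_self]
      rfl
    rw [hm', Basis.det_apply, hM, Matrix.det_transpose, ← RingHom.map_det]
    rfl
  have hone : (1 : K) ∈ frobeniusNormSet γ' R :=
    ⟨fun i => m (σ i), by rw [← hγ'f, Basis.det_self, one_pow]; rfl⟩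
  have hnorm1 : frobeniusNorm γ' R = Submodule.span R {1} := by
    refine le_antisymm ?_ (by
      rw [Submodule.span_singleton_le_iff_mem]; exact frobeniusNormSet_subset_frobeniusNorm hone)
    rw [frobeniusNorm, Submodule.span_le]
    intro d hd
    obtain ⟨r, hr⟩ := hsub hd
    rw [SetLike.mem_coe, Submodule.mem_span_singleton]
    exact ⟨r, by rw [Algebra.smul_def, mul_one, hr]⟩
  obtain ⟨v, hv⟩ := mem_iterateFrobeniusRange_iff.mp (β.det γ').2
  refine ⟨σ, v, ?_, ?_⟩
  · rw [hv, hγ'f]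
  · rw [frobeniusNorm_basis_change (β := γ') β hv, hnorm1, Submodule.map_span,
      Set.image_singleton, LinearMap.mulLeft_apply, mul_one]

/-- **The Frobenius norm ideal is principal near a regular point, granted Kunz flatness**: for an
F-finite Noetherian domain `A` with fraction field `K` of characteristic `p`, a Frobenius norm
ideal `I ⊆ A` and a prime `𝔭` with `A_𝔭` regular, `t · I ⊆ (j)` for some `t ∉ 𝔭`, `0 ≠ j ∈ I`
(the previous steps at `R = A_𝔭`, then clear finitely many denominators), i.e.
`I · A[1/t] = (j)`. [cite: Yasuda2012, Prop. 2.7; Kunz1969, Thm. 2.1] -/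
theorem exists_local_generator {p : ℕ} [Fact p.Prime] {e : ℕ} {K : Type} [Field K] [CharP K p]
    {A : Type} [CommRing A] [IsDomain A] [IsNoetherianRing A] [Algebra A K] [IsFractionRing A K]
    (hF : IsFFinite p e A)
    (hK : ∀ (R : Type) [CommRing R] [CharP R p] [IsRegularLocalRing R], (frobenius R p).Flat)
    {I : Ideal A} (hI : IsFrobeniusNormIdeal K p e I) (𝔭 : Ideal A) [𝔭.IsPrime]
    (hreg : IsRegularLocalRing (Localization.AtPrime 𝔭)) :
    ∃ t ∉ 𝔭, ∃ j ∈ I, j ≠ 0 ∧ ∀ g ∈ I, ∃ a : A, t * g = a * j := by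
  classical
  let R := Localization.AtPrime 𝔭
  have hinjAK : Function.Injective (algebraMap A K) := IsFractionRing.injective A K
  haveI : CharP A p := (algebraMap A K).charP hinjAK p
  haveI : CharP R p :=
    charP_of_injective_algebraMap (IsLocalization.injective R 𝔭.primeCompl_le_nonZeroDivisors) p
  haveI : IsRegularLocalRing R := hreg
  -- Kunz: the iterated Frobenius of `R = A_𝔭` is flat; a basis of `R` over `R^q` inside `A`
  obtain ⟨κ, _, m, hspan, hind⟩ := exists_frobeniusBasis_of_flat 𝔭.primeCompl
    (hF.of_isLocalization 𝔭.primeCompl R) (flat_iterateFrobenius (hK R) e)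
  have hunit : ∀ y : 𝔭.primeCompl, IsUnit (algebraMap A K y) := fun y =>
    isUnit_iff_ne_zero.mpr ((map_ne_zero_iff _ hinjAK).mpr fun h => y.2 (h ▸ 𝔭.zero_mem))
  letI : Algebra R K := (IsLocalization.lift (M := 𝔭.primeCompl) hunit).toAlgebra
  haveI : IsScalarTower A R K :=
    IsScalarTower.of_algebraMap_eq fun a => (IsLocalization.lift_eq hunit a).symm
  haveI : IsFractionRing R K :=
    IsFractionRing.isFractionRing_of_isDomain_of_isLocalization 𝔭.primeCompl R K
  -- the norm of `R` is principal, generated by an element `v = j / 1` of the norm set of `A`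
  obtain ⟨ι, _, _, β, hβ⟩ := hI
  obtain ⟨σ, v, hv, hnorm⟩ :=
    frobeniusNorm_eq_span_singleton_of_basis β (R := R) (fun i => algebraMap A R (m i)) hspan hind
  have hvA : v ∈ frobeniusNormSet β A := ⟨fun i => m (σ i), hv.trans
    (congrArg (fun w : ι → K => ((β.det w : iterateFrobeniusRange K p e) : K))
      (funext fun i => (IsScalarTower.algebraMap_apply A R K (m (σ i))).symm))⟩
  obtain ⟨j, hjI, hjv⟩ := (IsLocalization.mem_coeSubmodule K I).mp
    (hβ ▸ frobeniusNormSet_subset_frobeniusNorm hvA)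
  have hj0 : j ≠ 0 := by
    rintro rfl
    rw [map_zero] at hjv
    exact frobeniusNorm_ne_bot (β := β) (A := R)
      (by rw [hnorm, ← hjv, Submodule.span_singleton_eq_bot])
  -- `I ⊆ j · A_𝔭`: every `g ∈ I` has `t g = a j` with `t ∉ 𝔭`
  have hIR : IsLocalization.coeSubmodule K I ≤ (Submodule.span R {v}).restrictScalars A := by
    rw [hβ, frobeniusNorm, Submodule.span_le, Submodule.coe_restrictScalars, ← hnorm]
    exact (frobeniusNormSet_subset β A R).trans frobeniusNormSet_subset_frobeniusNorm
  have key : ∀ g : A, ∃ t ∉ 𝔭, ∃ a : A, g ∈ I → t * g = a * j := by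
    intro g
    by_cases hg : g ∈ I
    · obtain ⟨r, hr⟩ := Submodule.mem_span_singleton.mp
        (hIR ((IsLocalization.mem_coeSubmodule K I).mpr ⟨g, hg, rfl⟩))
      obtain ⟨x, hx⟩ := IsLocalization.surj 𝔭.primeCompl r
      refine ⟨x.2, x.2.2, x.1, fun _ => hinjAK ?_⟩
      have h3 : algebraMap R K r * algebraMap A K x.2 = algebraMap A K x.1 := by
        rw [IsScalarTower.algebraMap_apply A R K (x.2 : A),
          IsScalarTower.algebraMap_apply A R K x.1, ← map_mul, hx]
      rw [map_mul, map_mul, hjv, ← hr, Algebra.smul_def, ← h3]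
      ring
    · exact ⟨1, fun h => Ideal.IsPrime.ne_top ‹_› ((Ideal.eq_top_iff_one 𝔭).mpr h), 0,
        fun h => (hg h).elim⟩
  choose t ht a hta using key
  -- clear the denominators of finitely many generators
  obtain ⟨G, hG⟩ := (IsNoetherian.noetherian I : I.FG)
  have hGI : ∀ g ∈ G, g ∈ I := fun g hg => hG ▸ Submodule.subset_span hg
  refine ⟨∏ g ∈ G, t g, prod_mem (S := 𝔭.primeCompl) fun g _ => ht g, j, hjI, hj0, fun g hg => ?_⟩
  let J : Ideal A := Submodule.comap (LinearMap.mulLeft A (∏ g ∈ G, t g)) (Ideal.span {j})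
  have hGJ : (G : Set A) ⊆ J := by
    intro g' hg'
    rw [SetLike.mem_coe, Submodule.mem_comap, LinearMap.mulLeft_apply, Ideal.mem_span_singleton']
    refine ⟨(∏ x ∈ G.erase g', t x) * a g', ?_⟩
    rw [mul_assoc, ← hta g' (hGI g' hg'), ← Finset.mul_prod_erase G t hg']
    ring
  obtain ⟨a', ha'⟩ := Ideal.mem_span_singleton'.mp ((hG ▸ Submodule.span_le.mpr hGJ : I ≤ J) hg)
  exact ⟨a', ha'.symm⟩

/-- **The centre of an F-blowup is an effective Cartier divisor over a regular affine open**
(granted Kunz flatness): for a nonempty affine open `W ⊆ Reg X` of an integral scheme locally of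
finite type over a perfect field of characteristic `p` (`Γ(X, W)` is an F-finite Noetherian
domain) and a Frobenius norm ideal `I ⊆ Γ(X, W)`, the ideal sheaf `Ĩ` is generated on the basic
open `D(t) ∋ x` of `exists_local_generator` by the non-zero-divisor `j`. [cite: Yasuda2012, 2.7] -/
theorem isEffectiveCartier_idealSheaf
    (hK : ∀ (p : ℕ) [Fact p.Prime] (R : Type) [CommRing R] [CharP R p] [IsRegularLocalRing R],
      (frobenius R p).Flat)
    {p : ℕ} [Fact p.Prime] {k : Type} [Field k] [CharP k p] [PerfectField k] {e : ℕ}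
    {X : Scheme.{0}} (f : X ⟶ Spec (.of k)) [IsIntegral X] [LocallyOfFiniteType f]
    [CharP X.functionField p] (W : X.affineOpens) [Nonempty (W : X.Opens)]
    (hW : ((W : X.Opens) : Set X) ⊆ Scheme.regularLocus X) {I : Ideal Γ(X, W)}
    (hI : IsFrobeniusNormIdeal X.functionField p e I) :
    IsEffectiveCartier (affineBlowup.idealSheaf I) := by
  classical
  haveI : IsFractionRing Γ(X, W) X.functionField :=
    functionField_isFractionRing_of_isAffineOpen X W W.2
  haveI : IsLocallyNoetherian X := LocallyOfFiniteType.isLocallyNoetherian f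
  haveI : IsNoetherianRing Γ(X, W) := IsLocallyNoetherian.component_noetherian W
  -- `Γ(X, W)` is of finite type over the perfect field `k`, hence F-finite
  have hFF : IsFFinite p e Γ(X, W) := by
    let φ : k →+* Γ(X, W) :=
      (f.appLE ⊤ (W : X.Opens) le_top).hom.comp (Scheme.ΓSpecIso (.of k)).inv.hom
    have hφ : φ.FiniteType :=
      (HasRingHomProperty.appLE @LocallyOfFiniteType f ‹_› ⟨⊤, isAffineOpen_top _⟩ W le_top).comp
        (RingHom.FiniteType.of_surjective _
          (Scheme.ΓSpecIso (.of k)).symm.commRingCatIsoToRingEquiv.surjective)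
    letI : Algebra k Γ(X, W) := φ.toAlgebra
    haveI : Algebra.FiniteType k Γ(X, W) := hφ
    exact isFFinite_of_finiteType_of_perfectRing k p e Γ(X, W)
  intro x
  -- the local ring at `x` is regular: a generator `j` of `I` on some `D(t) ∋ x`
  have hreg : IsRegularLocalRing (Localization.AtPrime x.asIdeal) :=
    (mem_regularLocus x).mp ((mem_regularLocus_fromSpec_iff W.2 x).mp
      (hW (W.2.range_fromSpec.le ⟨x, rfl⟩)))
  obtain ⟨t, ht, j, hjI, hj0, hkey⟩ :=
    exists_local_generator hFF (fun R _ _ _ => hK p R) hI x.asIdeal hreg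
  -- the basic open `D(t)` of `S = Spec Γ(X, W)`; its sections `B = Γ(X, W)[1/t]`
  let S := Spec (CommRingCat.of Γ(X, W))
  let ε : Γ(S, ⊤) ≅ CommRingCat.of Γ(X, W) := Scheme.ΓSpecIso (CommRingCat.of Γ(X, W))
  let t' : Γ(S, ⊤) := ε.inv t
  have hU : IsAffineOpen (S.basicOpen t') := (isAffineOpen_top S).basicOpen t'
  have hxU : x ∈ S.basicOpen t' := by
    rw [basicOpen_eq_of_affine]
    exact (PrimeSpectrum.mem_basicOpen _ _).mpr ht
  refine ⟨⟨_, hU⟩, hxU, ?_⟩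
  let B := Γ(S, S.basicOpen t')
  let h : Γ(S, ⊤) ≃+* Γ(X, W) := ε.commRingCatIsoToRingEquiv
  haveI : IsLocalization.Away t' B := (isAffineOpen_top S).isLocalization_basicOpen t'
  letI : Algebra Γ(X, W) B := ((algebraMap Γ(S, ⊤) B).comp h.symm.toRingHom).toAlgebra
  haveI : IsLocalization.Away t B := by
    have := IsLocalization.isLocalization_of_base_ringEquiv (Submonoid.powers t') B h
    rwa [Submonoid.map_powers, show h t' = t from Iso.inv_hom_id_apply ε t] at this
  have hM : Submonoid.powers t ≤ nonZeroDivisors Γ(X, W) :=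
    powers_le_nonZeroDivisors_of_noZeroDivisors fun h => ht (h ▸ x.asIdeal.zero_mem)
  haveI : IsDomain B := IsLocalization.isDomain_of_le_nonZeroDivisors B hM
  have hinj : Function.Injective (algebraMap Γ(X, W) B) := IsLocalization.injective B hM
  refine ⟨algebraMap Γ(X, W) B j,
    mem_nonZeroDivisors_of_ne_zero ((map_ne_zero_iff _ hinj).mpr hj0), ?_⟩
  -- `Ĩ(D(t)) = I · B = (j)`
  have hideal : (affineBlowup.idealSheaf I).ideal ⟨_, hU⟩ = I.map (algebraMap Γ(X, W) B) := by
    rw [affineBlowup.idealSheaf, Scheme.IdealSheafData.ofIdealTop_ideal, Ideal.map_map]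
    rfl
  rw [hideal]
  refine le_antisymm ?_ (by
    rw [Ideal.span_le, Set.singleton_subset_iff]; exact Ideal.mem_map_of_mem _ hjI)
  rw [Ideal.map_le_iff_le_comap]
  intro g hg
  obtain ⟨a, hag⟩ := hkey g hg
  obtain ⟨u, hu⟩ := (IsLocalization.Away.algebraMap_isUnit (S := B) t).exists_left_inv
  rw [Ideal.mem_comap, Ideal.mem_span_singleton']
  refine ⟨u * algebraMap Γ(X, W) B a, ?_⟩
  calc u * algebraMap Γ(X, W) B a * algebraMap Γ(X, W) B j = u * algebraMap Γ(X, W) B (t * g) := by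
        rw [hag, map_mul]; ring
    _ = algebraMap Γ(X, W) B g := by rw [map_mul, ← mul_assoc, hu, one_mul]

/-- **STUB `stub_kunzIso` (Kunz ⇒ F-blowups are isomorphisms over the regular locus; Yasuda
2012, Prop. 2.7 / Cor. 2.6).** Granted the flatness of the Frobenius of regular local rings of
characteristic `p` (Kunz 1969, Thm. 2.1, a hypothesis), an `e`-th F-blowup of an integral scheme
locally of finite type over a perfect field of characteristic `p` is an isomorphism over every
open `U ⊆ Reg X`: `IsIso` is local on the target, and over a nonempty affine open `W ⊆ U` it is a
blowing up along an effective Cartier divisor (`isEffectiveCartier_idealSheaf`, `IsBlowup.isIso`).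
[cite: Yasuda2012, Prop. 2.7 and Cor. 2.6; Kunz1969, Thm. 2.1] -/
theorem stub_kunzIso :
    (∀ (p : ℕ) [Fact p.Prime] (R : Type) [CommRing R] [CharP R p] [IsRegularLocalRing R],
        (frobenius R p).Flat) →
    ∀ (p : ℕ) [Fact p.Prime] (k : Type) [Field k] [CharP k p] [PerfectField k] (e : ℕ), 0 < e →
      ∀ (X Y : Scheme.{0}) (f : X ⟶ Spec (.of k)) [IsIntegral X] [LocallyOfFiniteType f]
      [CharP X.functionField p] (g : Y ⟶ X), IsFBlowup p e g →
      ∀ (U : X.Opens), (U : Set X) ⊆ Scheme.regularLocus X → IsIso (g ∣_ U) := by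
  intro hK p _ k _ _ _ e _ X Y f _ _ _ g hg U hU
  refine IsZariskiLocalAtTarget.of_iSup_eq_top (P := MorphismProperty.isomorphisms Scheme)
    (fun V : {V : (U : Scheme.{0}).affineOpens // Nonempty (V : (U : Scheme.{0}).Opens)} =>
      (V.1 : (U : Scheme.{0}).Opens)) ?_ fun V => ?_
  · rw [eq_top_iff]
    rintro x -
    obtain ⟨V, hxV⟩ := IsFBlowup.exists_affineOpens_mem x
    exact Opens.mem_iSup.mpr ⟨⟨V, ⟨⟨x, hxV⟩⟩⟩, hxV⟩
  · obtain ⟨V, hne⟩ := V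
    refine ((MorphismProperty.isomorphisms Scheme).arrow_mk_iso_iff
      (morphismRestrictRestrict g U (V : (U : Scheme.{0}).Opens))).mpr ?_
    let W : X.affineOpens :=
      ⟨U.ι ''ᵁ (V : (U : Scheme.{0}).Opens), V.2.image_of_isOpenImmersion U.ι⟩
    haveI : Nonempty (W : X.Opens) := by
      obtain ⟨v⟩ := hne
      exact ⟨⟨U.ι v.1, v.1, v.2, rfl⟩⟩
    have hWreg : ((W : X.Opens) : Set X) ⊆ Scheme.regularLocus X := fun x hx =>
      hU (Scheme.Opens.ι_image_le U _ hx)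
    change IsIso (g ∣_ (W : X.Opens))
    obtain ⟨I, hI, hb⟩ := hg.exists_isBlowup W
    haveI := hb.isIso (isEffectiveCartier_idealSheaf hK f W hWreg hI)
    exact IsIso.of_isIso_comp_right (g ∣_ (W : X.Opens)) W.2.isoSpec.hom

end Summit.ResolutionOfSingularities.ResolutionOfSingularities.Theorems.WeightedThesis.KunzTower

end
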